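import Summits.QuantumFields.BalabanUV.Beta.EriceRemainderEnclosureHistoryTwoLoop

/-!
# EriceRemainderEnclosureHistoryTwoLoopSharp — (E30b) THE FIRST MOMENT IS LOAD-BEARING FOR THE VALUE: a history family with a
# TWO-POINT history modulus of bounded total weight `4cγ` but NON-FADING memory (weight `cγ` at age k) whose DIAGONAL (Erice ∕ Markov
# shadow) has ZERO two-loop part, yet along EVERY run of (0.20) the bare coupling obeys the two-loop law with coefficient `c∕b ≠ 0`
# — so the shadow's value `0` FAILS: without a first-moment (fading) condition the history can move the two-loop VALUE

Cell `pub-balaban`, β-function sub-cell, BINDER row D4 «RemainderConst leaves for Bałaban's split» (`HOME/BINDER-OWNERS.md`; owner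
lineage `b2b-balaban-beta-an4`; this file by co-owner #2 lineage `b2b-balaban-beta-d4-p2`, generation 32; companion of (E30)
`EriceRemainderEnclosureHistoryTwoLoop`, same INTENT S-d4p2-g32-1), β-FLOW TEAM duty (1) under the rulings «YM REDIRECT» (FREEZE (0)
honoured: def-free module in the lineage's own `EriceRemainderEnclosure*` series) and «YM ACCELERATION» item (2).  (E30) proved: node
U2's `HistLipschitz` WITH a bounded first moment `Σ_i (k − i)Λ k i` (⇐ `FadingMemory`, θ < 1) carries the two-loop law of the bare
coupling from the diagonal to the history-dependent family, shape AND value.  THIS FILE is the necessity witness for the moment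
condition: bounded TOTAL weight `Σ_i Λ k i` — the JUNCTION's price in the OWNER's (D4-J2) `osc_le_of_histLipschitz` — does NOT fix the value.

HONEST FRAMING (page 1 of everything the β sub-cell writes).  *"Discharging BetaPertH makes Bałaban's UV stability UNCONDITIONAL —
a real constructive-QFT result; it is NOT the continuum limit and NOT the Clay problem."*  THIS FILE DISCHARGES NOTHING OF THE
KIND.  It is elementary bookkeeping about ONE TOY history family (ours, not Bałaban's) in the tree's typing `FlowStep.HBeta`, carried
as a HYPOTHESIS `hβ : ∀ k p, β k p = b + c·p_k·(p_k − p_0)` on an abstract `β` (def-free; the last theorem instantiates it by `rfl`):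
one-loop part `β⁰ ≡ b > 0`, remainder `β¹_{k+1}(g_0,…,g_k) = c·g_k·(g_k − g_0)` (vanishing at `g_k = 0`, [I] (2.12)–(2.14) p. 268), with
`c > 0` and the box smallness `2cγ² ≤ b`.  Nothing of Bałaban's (1.22) is asserted or constructed; row D4 class UNCHANGED
(critical-path width 0; instance 0∕1; D4 DISCHARGE NO DATE); NOT B12 Thm 2, NOT BetaPertH, NOT continuum, NOT Clay.  HONEST
DEPENDENCY: continuum YM on T⁴ ⇐ BetaPertH ∧ nine spine estimates (0/9 proved); BetaPertH ⇐ (D1) ∧ (D4) ∧ CAP+tail; G-an2-4 gates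
asym, D1 and NE2/3/4.  ABSOLUTE RULE: nothing is cited as a fact; the family is ours and explicit.

WHAT IS PROVED ([folklore]; 0 sorry; 0 `def`).
* §1 THE FAMILY: `exists_split` (a printed split with one-loop part `b`), `β1_eq` (every such split has remainder `c·p_k·(p_k − p_0)`),
  `diagTL_zero` (on CONSTANT histories `β¹ = 0`: the diagonal obeys node U2's (TL) with `β¹¹_∞ = 0`, `C₃ = c₁ = 0`), `af1`
  (`|β¹| ≤ cγ·p_k`), `lower` ∕ `upper` (`b∕2 ≤ β ≤ 3b∕2` on the boxes), `continuousOn`.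
* §2 THE MEMORY: `histLipschitz` — node U2's `HistLipschitz Λ γ β` with the TWO-POINT modulus `Λ k i = 3cγ·[i = k] + cγ·[i = 0, k ≠ 0]`
  (total weight ≤ 4cγ at every k); `not_fadingMemory` — for every `C` and `θ < 1`, `¬ FadingMemory C θ Λ` (the weight `cγ` sits at
  AGE k and does not decay; first moment `k·cγ → ∞`).
* §3 THE RUNS: `twoLoopLaw_run` — along every solution of (0.20) in the box with `K ≥ 1` steps,
  `|1/(gs 0)² − 1/(gs K)² − K·b − (c∕b)·log K| ≤ Q(1/(gs K)²)`, `Q(P) = twoLoopConst (b∕2) b γ (cγ) 0 0 c 0 0 0 0 P + 4c∕b` — by (E30)'s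
  CHANNEL engine `abs_invSq_bare_sub_twoLoop_le_alongRun` with `r k = −c·g_k·g_0` (`|Σ r| ≤ c·g_0·Σ g_k ≤ 4c∕b`: node U2's
  `sum_run_le`, `run_le_inv_sqrt` BY NAME); `runs_exist` (the [I]-side shooting theorem `FlowStep.couplingTrajectory_exists_history`).
* §4 END **`boundedWeight_not_sufficient_for_value`**: for every renormalized `g ∈ ]0,γ]` the runs ending at `g` obey the law with
  coefficient `c∕b`, and NO `K`-uniform bound `|1/(gs 0)² − 1/g² − K·b| ≤ Q′` (the diagonal's value `0`) holds over them; in node U2's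
  chart currency `tendsto_twoLoopCoeff_bareOf_family`: `(1/g₀(L^{−K}, g)² − 1/g² − K·b)/log K → c∕b` (the diagonal reads `0`); instance
  `family_boundedWeight_not_sufficient` (the explicit `β`, by `rfl`); and `e30_binders_inhabited`: (E30)'s fading-memory binders are
  JOINTLY inhabited by node U2's §7 Markov two-loop family `b + c·p_k²` (last-only modulus, `FadingMemory (2cγ) 0`).
READING (sense (α)): (E30)'s sufficient condition «first moment bounded» cannot be weakened to «total weight bounded» — the run's past
`g_0` is tiny but it is seen with UNDIMINISHED weight at every later scale, and `Σ_k c·g_k² = (c∕b)·log K + O(1)` is exactly a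
two-loop term.  All letters NOT-IN-PRINT; no junction of `BetaFlowAsPrinted` changes.
-/

noncomputable section

open Finset Filter Topology

namespace Summit.QuantumFields.BalabanUV.Beta.EriceRemainderEnclosureHistoryTwoLoopSharp

open Literature.MathematicalPhysics.QuantumFieldTheory.Balaban1983to89
open Literature.MathematicalPhysics.QuantumFieldTheory.Balaban1983to89.FlowStep
open Literature.MathematicalPhysics.QuantumFieldTheory.Balaban1983to89.T4CouplingMatching
open Literature.MathematicalPhysics.QuantumFieldTheory.Balaban1983to89.T4OneLoopAsymptotics
open Literature.MathematicalPhysics.QuantumFieldTheory.Balaban1983to89.T4TwoLoopLaw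
open Literature.MathematicalPhysics.QuantumFieldTheory.Balaban1983to89.T4BareCouplingChart (bareOf)
open Summit.QuantumFields.BalabanUV.Beta.EriceRemainderEnclosureHistoryJunction (abs_sub_le_of_mem_Ioc)
open Summit.QuantumFields.BalabanUV.Beta.EriceRemainderEnclosureHistoryTwoLoop

variable {β : HBeta} {b c γ : ℝ}

/-! ## §1 The family `β_{k+1}(g_0,…,g_k) = b + c·g_k·(g_k − g_0)` (a hypothesis on an abstract `β`) -/

/-- A PRINTED split of the family with one-loop part `b` exists (the remainder `c·p_k·(p_k − p_0)` vanishes at `p_k = 0`).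
[cite: Balaban1987RG1, (2.12)–(2.14) p.268] -/
theorem exists_split (hβ : ∀ (k : ℕ) (p : Fin (k + 1) → ℝ), β k p = b + c * p (Fin.last k) * (p (Fin.last k) - p 0)) :
    ∃ S : B12Beta.OneLoopSplit β, ∀ k, S.β0 k = b :=
  ⟨⟨fun _ => b, fun k p => c * p (Fin.last k) * (p (Fin.last k) - p 0), fun k p => hβ k p,
    fun k p hp => by simp [hp]⟩, fun _ => rfl⟩

/-- Every split with one-loop part `b` has remainder `β¹ = c·p_k·(p_k − p_0)`. [folklore] -/
theorem β1_eq (hβ : ∀ (k : ℕ) (p : Fin (k + 1) → ℝ), β k p = b + c * p (Fin.last k) * (p (Fin.last k) - p 0))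
    (S : B12Beta.OneLoopSplit β) (hS : ∀ k, S.β0 k = b) (k : ℕ) (p : Fin (k + 1) → ℝ) :
    S.β1 k p = c * p (Fin.last k) * (p (Fin.last k) - p 0) := by
  have h := S.split k p
  rw [hS k, hβ k p] at h
  linarith

/-- THE DIAGONAL IS TWO-LOOP FREE: on constant histories `β¹ = 0`, so the diagonal obeys node U2's (TL) with `β¹¹_∞ = 0` and
`C₃ = c₁ = 0` (rate `θ₁ = 0`) — the Erice ∕ Markov shadow of the family predicts NO logarithm. [folklore] -/
theorem diagTL_zero (hβ : ∀ (k : ℕ) (p : Fin (k + 1) → ℝ), β k p = b + c * p (Fin.last k) * (p (Fin.last k) - p 0))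
    (S : B12Beta.OneLoopSplit β) (hS : ∀ k, S.β0 k = b) (k : ℕ) (x : ℝ) (_hx : 0 < x) (_hxγ : x ≤ γ) :
    |S.β1 k (fun _ : Fin (k + 1) => x) - 0 * x ^ 2| ≤ 0 * x ^ 3 + 0 * (0 : ℝ) ^ k := by
  rw [β1_eq hβ S hS]; simp

/-- (AF-1) for the family: `|β¹(p)| ≤ cγ·p_k` on the boxes (`|p_k − p_0| ≤ γ`), `c ≥ 0`. [folklore] -/
theorem af1 (hβ : ∀ (k : ℕ) (p : Fin (k + 1) → ℝ), β k p = b + c * p (Fin.last k) * (p (Fin.last k) - p 0))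
    (S : B12Beta.OneLoopSplit β) (hS : ∀ k, S.β0 k = b) (hc : 0 ≤ c) (k : ℕ) (p : Fin (k + 1) → ℝ) (hp : p ∈ Box γ k) :
    |S.β1 k p| ≤ c * γ * p (Fin.last k) := by
  rw [β1_eq hβ S hS, abs_mul, abs_mul, abs_of_nonneg hc, abs_of_pos (mem_box.1 hp _).1]
  have h := abs_sub_le_of_mem_Ioc (mem_box.1 hp (Fin.last k)) (mem_box.1 hp 0)
  calc c * p (Fin.last k) * |p (Fin.last k) - p 0| ≤ c * p (Fin.last k) * γ :=
        mul_le_mul_of_nonneg_left h (mul_nonneg hc (mem_box.1 hp _).1.le)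
    _ = c * γ * p (Fin.last k) := by ring

/-- LOWER bound on the boxes: `b∕2 ≤ β` when `2cγ² ≤ b` (`β ≥ b − c·p_k·p_0 ≥ b − cγ²`), `c ≥ 0`. [folklore] -/
theorem lower (hβ : ∀ (k : ℕ) (p : Fin (k + 1) → ℝ), β k p = b + c * p (Fin.last k) * (p (Fin.last k) - p 0))
    (hc : 0 ≤ c) (hγ : 0 < γ) (hsmall : 2 * c * γ ^ 2 ≤ b) (k : ℕ) (p : Fin (k + 1) → ℝ) (hp : p ∈ Box γ k) :
    b / 2 ≤ β k p := by
  rw [hβ k p]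
  have hk := mem_box.1 hp (Fin.last k)
  have h0 := mem_box.1 hp 0
  have h1 : c * p (Fin.last k) * p 0 ≤ c * γ * γ :=
    mul_le_mul (mul_le_mul_of_nonneg_left hk.2 hc) h0.2 h0.1.le (mul_nonneg hc hγ.le)
  nlinarith [mul_nonneg (mul_nonneg hc hk.1.le) hk.1.le]

/-- UPPER bound on the boxes: `β ≤ 3b∕2` when `2cγ² ≤ b`, `c ≥ 0`. [folklore] -/
theorem upper (hβ : ∀ (k : ℕ) (p : Fin (k + 1) → ℝ), β k p = b + c * p (Fin.last k) * (p (Fin.last k) - p 0))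
    (hc : 0 ≤ c) (hγ : 0 < γ) (hsmall : 2 * c * γ ^ 2 ≤ b) (k : ℕ) (p : Fin (k + 1) → ℝ) (hp : p ∈ Box γ k) :
    β k p ≤ 3 * b / 2 := by
  rw [hβ k p]
  have hk := mem_box.1 hp (Fin.last k)
  have h0 := mem_box.1 hp 0
  have h1 : c * p (Fin.last k) * p (Fin.last k) ≤ c * γ * γ :=
    mul_le_mul (mul_le_mul_of_nonneg_left hk.2 hc) hk.2 hk.1.le (mul_nonneg hc hγ.le)
  nlinarith [mul_nonneg (mul_nonneg hc hk.1.le) h0.1.le]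

/-- Each `β k` is continuous (a polynomial in the coordinates), in particular on the box. [folklore] -/
theorem continuousOn (hβ : ∀ (k : ℕ) (p : Fin (k + 1) → ℝ), β k p = b + c * p (Fin.last k) * (p (Fin.last k) - p 0))
    (k : ℕ) : ContinuousOn (β k) (Box γ k) := by
  have e : β k = fun p => b + c * p (Fin.last k) * (p (Fin.last k) - p 0) := funext (hβ k)
  rw [e]
  fun_prop

/-! ## §2 The memory: a two-point `HistLipschitz` modulus of total weight `4cγ` which is NOT fading -/

/-- **NODE U2's `HistLipschitz` WITH A TWO-POINT MODULUS.**  For `c ≥ 0`, with `Λ k i = 3cγ·[i = k] + cγ·[i = 0 ∧ k ≠ 0]` (weights only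
on the PRESENT coupling and on the BARE one; total ≤ 4cγ): `|β(p) − β(q)| ≤ Σ_i Λ k i·|p_i − q_i|` on the boxes — from
`p_k(p_k − p_0) − q_k(q_k − q_0) = (p_k − q_k)(p_k + q_k − p_0) − q_k(p_0 − q_0)`. [folklore] -/
theorem histLipschitz (hβ : ∀ (k : ℕ) (p : Fin (k + 1) → ℝ), β k p = b + c * p (Fin.last k) * (p (Fin.last k) - p 0))
    (hc : 0 ≤ c) (hγ : 0 < γ) :
    HistLipschitz (fun k i => if i = k then 3 * c * γ else if i = 0 then c * γ else 0) γ β := by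
  intro k p q hp hq
  rcases Nat.eq_zero_or_pos k with hk0 | hkpos
  · subst hk0
    have e : β 0 p - β 0 q = 0 := by
      rw [hβ 0 p, hβ 0 q]; simp [show (Fin.last 0 : Fin 1) = 0 from rfl]
    rw [e, abs_zero]
    exact sum_nonneg fun i _ => mul_nonneg (by dsimp only; split_ifs <;> positivity) (abs_nonneg _)
  · have hk0 : k ≠ 0 := Nat.pos_iff_ne_zero.1 hkpos
    have hne : (0 : Fin (k + 1)) ≠ Fin.last k := by
      intro h; have := congrArg Fin.val h; simp at this; omega
    have hfnn : ∀ i : Fin (k + 1),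
        0 ≤ (if (i : ℕ) = k then 3 * c * γ else if (i : ℕ) = 0 then c * γ else 0) * |p i - q i| :=
      fun i => mul_nonneg (by split_ifs <;> positivity) (abs_nonneg _)
    have hlow : (if ((0 : Fin (k + 1)) : ℕ) = k then 3 * c * γ else if ((0 : Fin (k + 1)) : ℕ) = 0 then c * γ else 0) *
          |p 0 - q 0| +
        (if ((Fin.last k : Fin (k + 1)) : ℕ) = k then 3 * c * γ else if ((Fin.last k : Fin (k + 1)) : ℕ) = 0 then c * γ
          else 0) * |p (Fin.last k) - q (Fin.last k)| ≤
        ∑ i : Fin (k + 1), (if (i : ℕ) = k then 3 * c * γ else if (i : ℕ) = 0 then c * γ else 0) * |p i - q i| := by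
      have h1 : ∑ i ∈ ({0, Fin.last k} : Finset (Fin (k + 1))),
          (if (i : ℕ) = k then 3 * c * γ else if (i : ℕ) = 0 then c * γ else 0) * |p i - q i| =
          (if ((0 : Fin (k + 1)) : ℕ) = k then 3 * c * γ else if ((0 : Fin (k + 1)) : ℕ) = 0 then c * γ else 0) *
              |p 0 - q 0| +
            (if ((Fin.last k : Fin (k + 1)) : ℕ) = k then 3 * c * γ else if ((Fin.last k : Fin (k + 1)) : ℕ) = 0 then c * γ
              else 0) * |p (Fin.last k) - q (Fin.last k)| := by
        simp only [sum_pair hne]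
      rw [← h1]
      exact sum_le_sum_of_subset_of_nonneg (subset_univ _) fun i _ _ => hfnn i
    have h0v : ((0 : Fin (k + 1)) : ℕ) = 0 := rfl
    have hlv : ((Fin.last k : Fin (k + 1)) : ℕ) = k := Fin.val_last k
    rw [h0v, hlv, if_neg (Ne.symm hk0), if_pos rfl, if_pos rfl] at hlow
    have hpk := mem_box.1 hp (Fin.last k); have hp0 := mem_box.1 hp 0
    have hqk := mem_box.1 hq (Fin.last k); have hq0 := mem_box.1 hq 0
    have e : β k p - β k q = c * ((p (Fin.last k) - q (Fin.last k)) * (p (Fin.last k) + q (Fin.last k) - p 0) -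
        q (Fin.last k) * (p 0 - q 0)) := by rw [hβ k p, hβ k q]; ring
    have hA : |(p (Fin.last k) - q (Fin.last k)) * (p (Fin.last k) + q (Fin.last k) - p 0)| ≤
        3 * γ * |p (Fin.last k) - q (Fin.last k)| := by
      rw [abs_mul, mul_comm]
      refine mul_le_mul_of_nonneg_right ?_ (abs_nonneg _)
      rw [abs_le]; constructor <;> linarith [hpk.1, hpk.2, hqk.1, hqk.2, hp0.1, hp0.2]
    have hB : |q (Fin.last k) * (p 0 - q 0)| ≤ γ * |p 0 - q 0| := by
      rw [abs_mul, abs_of_pos hqk.1]; exact mul_le_mul_of_nonneg_right hqk.2 (abs_nonneg _)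
    calc |β k p - β k q| = c * |(p (Fin.last k) - q (Fin.last k)) * (p (Fin.last k) + q (Fin.last k) - p 0) -
          q (Fin.last k) * (p 0 - q 0)| := by rw [e, abs_mul, abs_of_nonneg hc]
      _ ≤ c * (3 * γ * |p (Fin.last k) - q (Fin.last k)| + γ * |p 0 - q 0|) :=
          mul_le_mul_of_nonneg_left ((abs_sub _ _).trans (add_le_add hA hB)) hc
      _ = c * γ * |p 0 - q 0| + 3 * c * γ * |p (Fin.last k) - q (Fin.last k)| := by ring
      _ ≤ _ := hlow

/-- **THE MEMORY DOES NOT FADE**: for `c, γ > 0`, every `C` and every `θ ∈ [0,1[`, the two-point modulus violates node U2's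
`FadingMemory C θ Λ` — the weight of the bare coupling `Λ k 0 = cγ` sits at AGE `k` for every `k ≥ 1` while `Cθ^k → 0`; its total
weight `4cγ` is bounded, its first moment `k·cγ` is not. [folklore] -/
theorem not_fadingMemory (hc : 0 < c) (hγ : 0 < γ) {C θ : ℝ} (hθ0 : 0 ≤ θ) (hθ1 : θ < 1) :
    ¬ FadingMemory C θ (fun k i => if i = k then 3 * c * γ else if i = 0 then c * γ else 0) := by
  intro hF
  have hlim : Tendsto (fun k : ℕ => C * θ ^ k) atTop (𝓝 0) := by
    simpa using (tendsto_pow_atTop_nhds_zero_of_lt_one hθ0 hθ1).const_mul C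
  obtain ⟨N, hN⟩ := (hlim.eventually (gt_mem_nhds (mul_pos hc hγ))).exists_forall_of_atTop
  have h := (hF (N + 1) 0 (Nat.zero_le _)).2
  dsimp only at h
  rw [if_neg (by omega), if_pos rfl, Nat.sub_zero] at h
  linarith [hN (N + 1) (Nat.le_succ N)]

/-! ## §3 The runs: the two-loop law with coefficient `c∕b` along every solution of (0.20), and their existence -/

/-- **THE TWO-LOOP LAW ALONG EVERY RUN OF THE FAMILY, COEFFICIENT `c∕b`.**  For `b, c, γ > 0`, `2cγ² ≤ b`, any split with one-loop
part `b`, and any solution `gs` of (0.20) with `K ≥ 1` steps in the box ]0,γ]: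
`|1/(gs 0)² − 1/(gs K)² − K·b − (c∕b)·log K| ≤ twoLoopConst (b∕2) b γ (cγ) 0 0 c 0 0 0 0 (1/(gs K)²) + 4c∕b`.
Along the run `β¹_k = c·g_k² − c·g_k·g_0`: (E30)'s engine with channel `r k = −c·g_k·g_0`, whose sum is `≤ c·g_0·Σ_k g_k ≤ 4c∕b`
(`g_0 ≤ 1/√((b∕2)K)`, `Σ_k g_k ≤ 2√K/√(b∕2)` — node U2's `run_le_inv_sqrt`, `sum_run_le`). [folklore] -/
theorem twoLoopLaw_run (hβ : ∀ (k : ℕ) (p : Fin (k + 1) → ℝ), β k p = b + c * p (Fin.last k) * (p (Fin.last k) - p 0))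
    (S : B12Beta.OneLoopSplit β) (hS : ∀ k, S.β0 k = b) (hb : 0 < b) (hc : 0 < c) (hγ : 0 < γ)
    (hsmall : 2 * c * γ ^ 2 ≤ b) {K : ℕ} {gs : ℕ → ℝ} (h : RGEqH K β gs) (hbox : ∀ k, k ≤ K → 0 < gs k ∧ gs k ≤ γ)
    (hK : 0 < K) :
    |1 / (gs 0) ^ 2 - 1 / (gs K) ^ 2 - (K : ℝ) * b - c / b * Real.log K| ≤
      twoLoopConst (b / 2) b γ (c * γ) 0 0 c 0 0 0 0 (1 / (gs K) ^ 2) + 4 * c / b := by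
  have hb2 : 0 < b / 2 := by positivity
  have hlo : EventualLowerH (b / 2) γ 0 β := fun k v _ hv => lower hβ hc.le hγ hsmall k v hv
  have hAF1 : ∀ k (p : Fin (k + 1) → ℝ), p ∈ Box γ k → |S.β1 k p| ≤ c * γ * p (Fin.last k) :=
    fun k p hp => af1 hβ S hS hc.le k p hp
  have hconv : ∀ k, |S.β0 k - b| ≤ 0 * (0 : ℝ) ^ k := fun k => by rw [hS k]; simp
  -- (TL) along the run with the channel r k = −c·g_k·g_0, exactly
  have hTL : ∀ k, k < K → |S.β1 k (prefixOf gs k) - c * (gs k) ^ 2 - (-(c * gs k * gs 0))| ≤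
      0 * (gs k) ^ 3 + 0 * (0 : ℝ) ^ k := by
    intro k hk
    rw [β1_eq hβ S hS]
    simp only [prefixOf_apply, Fin.val_last, Fin.val_zero]
    ring_nf; simp
  -- the channel: |Σ_{k<K} (−c g_k g_0)| ≤ c·g_0·Σ g_k ≤ 4c/b
  have hsum := sum_run_le h hbox hb2 hlo
  have hg0 := run_le_inv_sqrt h hbox hb2 hlo le_rfl hK
  simp only [Nat.cast_zero, zero_mul, zero_add, Nat.sub_zero] at hsum hg0
  have hsq : Real.sqrt (b / 2 * (K : ℝ)) = Real.sqrt (b / 2) * Real.sqrt (K : ℝ) := Real.sqrt_mul hb2.le _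
  have hsb : 0 < Real.sqrt (b / 2) := Real.sqrt_pos.2 hb2
  have hsK : 0 < Real.sqrt (K : ℝ) := Real.sqrt_pos.2 (by exact_mod_cast hK)
  have hg0pos : 0 < gs 0 := (hbox 0 (Nat.zero_le _)).1
  have hR : |∑ k ∈ range K, (-(c * gs k * gs 0))| ≤ 4 * c / b := by
    have e : ∑ k ∈ range K, (-(c * gs k * gs 0)) = -(c * gs 0 * ∑ k ∈ range K, gs k) := by
      rw [mul_sum, ← sum_neg_distrib]; exact sum_congr rfl fun k _ => by ring
    have hspos : 0 ≤ ∑ k ∈ range K, gs k := sum_nonneg fun k hk => (hbox k (mem_range.1 hk).le).1.le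
    rw [e, abs_neg, abs_of_nonneg (by positivity)]
    calc c * gs 0 * ∑ k ∈ range K, gs k
        ≤ c * (1 / Real.sqrt (b / 2 * (K : ℝ))) * (2 * Real.sqrt (K : ℝ) / Real.sqrt (b / 2)) :=
          mul_le_mul (mul_le_mul_of_nonneg_left hg0 hc.le) hsum hspos (by positivity)
      _ = 4 * c / b := by
          rw [hsq]
          field_simp
          rw [Real.sq_sqrt hb2.le]
          ring
  have hmain := abs_invSq_bare_sub_twoLoop_le_alongRun S h hbox hb2 hlo (by positivity) hAF1 le_rfl zero_lt_one hconv
    le_rfl le_rfl le_rfl zero_lt_one hTL hR hK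
  have hβ0sum : ∑ k ∈ range K, S.β0 k = (K : ℝ) * b := by
    rw [sum_congr rfl fun k _ => hS k, sum_const, card_range, nsmul_eq_mul]
  rw [hβ0sum] at hmain
  exact hmain

/-- **THE RUNS EXIST** (the [I]-side shooting theorem `FlowStep.couplingTrajectory_exists_history` BY NAME, from continuity and
`b∕2 ≤ β ≤ 3b∕2` on the boxes): for every `K` and every renormalized `g ∈ ]0,γ]` a solution of (0.20) in the box ending at `gs K = g`.
[cite: Balaban1987RG1, Thm 2 p.259] -/
theorem runs_exist (hβ : ∀ (k : ℕ) (p : Fin (k + 1) → ℝ), β k p = b + c * p (Fin.last k) * (p (Fin.last k) - p 0))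
    (hb : 0 < b) (hc : 0 ≤ c) (hγ : 0 < γ) (hsmall : 2 * c * γ ^ 2 ≤ b) (K : ℕ) {g : ℝ} (hg : 0 < g) (hgγ : g ≤ γ) :
    ∃ gs : ℕ → ℝ, gs K = g ∧ RGEqH K β gs ∧ ∀ k, k ≤ K → 0 < gs k ∧ gs k ≤ γ := by
  obtain ⟨gs, hK, hrg, hbox, -⟩ := couplingTrajectory_exists_history β hγ (half_pos hb) (by linarith : b / 2 ≤ 3 * b / 2)
    (continuousOn hβ) (lower hβ hc hγ hsmall) (upper hβ hc hγ hsmall) K g hg hgγ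
  exact ⟨gs, hK, hrg, hbox⟩

/-! ## §4 END: bounded total weight does not fix the two-loop value -/

/-- **BOUNDED TOTAL WEIGHT IS NOT SUFFICIENT FOR THE VALUE.**  For the family `β = b + c·g_k·(g_k − g_0)` (`b, c, γ > 0`, `2cγ² ≤ b`;
carried by `hβ`) and every renormalized `g ∈ ]0,γ]`: (i) along EVERY run of (0.20) in the box ending at `g` with `K ≥ 1` steps the
two-loop law holds with coefficient `c∕b` and the explicit `K`-free constant `Q`; (ii) there is NO `K`-uniform bound
`|1/(gs 0)² − 1/g² − K·b| ≤ Q′` over those runs — the value `0` read off the DIAGONAL (`diagTL_zero`) is WRONG, although the family's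
history modulus (`histLipschitz`) has bounded total weight `4cγ` — because it is not fading (`not_fadingMemory`): (E30)'s first-moment
condition is load-bearing for the VALUE. [folklore] -/
theorem boundedWeight_not_sufficient_for_value
    (hβ : ∀ (k : ℕ) (p : Fin (k + 1) → ℝ), β k p = b + c * p (Fin.last k) * (p (Fin.last k) - p 0))
    (hb : 0 < b) (hc : 0 < c) (hγ : 0 < γ) (hsmall : 2 * c * γ ^ 2 ≤ b) {g : ℝ} (hg : 0 < g) (hgγ : g ≤ γ) :
    (∀ (K : ℕ) (gs : ℕ → ℝ), 0 < K → RGEqH K β gs → (∀ k, k ≤ K → 0 < gs k ∧ gs k ≤ γ) → gs K = g →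
        |1 / (gs 0) ^ 2 - 1 / g ^ 2 - (K : ℝ) * b - c / b * Real.log K| ≤
          twoLoopConst (b / 2) b γ (c * γ) 0 0 c 0 0 0 0 (1 / g ^ 2) + 4 * c / b) ∧
      ¬ ∃ Q' : ℝ, ∀ (K : ℕ) (gs : ℕ → ℝ), 0 < K → RGEqH K β gs → (∀ k, k ≤ K → 0 < gs k ∧ gs k ≤ γ) → gs K = g →
        |1 / (gs 0) ^ 2 - 1 / g ^ 2 - (K : ℝ) * b| ≤ Q' := by
  obtain ⟨S, hS⟩ := exists_split hβ
  set Q : ℝ := twoLoopConst (b / 2) b γ (c * γ) 0 0 c 0 0 0 0 (1 / g ^ 2) + 4 * c / b with hQ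
  have hlaw : ∀ (K : ℕ) (gs : ℕ → ℝ), 0 < K → RGEqH K β gs → (∀ k, k ≤ K → 0 < gs k ∧ gs k ≤ γ) → gs K = g →
      |1 / (gs 0) ^ 2 - 1 / g ^ 2 - (K : ℝ) * b - c / b * Real.log K| ≤ Q := by
    intro K gs hK h hbox hend
    have := twoLoopLaw_run hβ S hS hb hc hγ hsmall h hbox hK
    rwa [hend] at this
  refine ⟨hlaw, ?_⟩
  rintro ⟨Q', hQ'⟩
  -- pick K with (c/b)·log K > Q + Q'
  have hcb : 0 < c / b := div_pos hc hb
  have hlog : Tendsto (fun K : ℕ => c / b * Real.log (K : ℝ)) atTop atTop :=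
    (Real.tendsto_log_atTop.comp tendsto_natCast_atTop_atTop).const_mul_atTop hcb
  obtain ⟨K, hK⟩ := ((hlog.eventually_gt_atTop (Q + Q')).and (eventually_gt_atTop 0)).exists
  obtain ⟨gs, hend, h, hbox⟩ := runs_exist hβ hb hc.le hγ hsmall K hg hgγ
  have h1 := hlaw K gs hK.2 h hbox hend
  have h2 := hQ' K gs hK.2 h hbox hend
  obtain ⟨h1l, -⟩ := abs_le.1 h1
  obtain ⟨-, h2r⟩ := abs_le.1 h2
  linarith [hK.1]

/-- **NODE U2's CHART READS THE COEFFICIENT `c∕b`, NOT THE DIAGONAL's `0`.**  For the chart `bareOf β γ K g` of node U2's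
`T4BareCouplingChart` (the bare coupling of SOME admissible run ending at `g`; no well-posedness package needed here, every admissible
run obeys the law): `(1/g₀(L^{−K}, g)² − 1/g² − K·b)/log K → c∕b` — node U2's `tendsto_twoLoopCoeff_bareOf` returns the DIAGONAL's
`β¹¹_∞/β⁰_∞ = 0` for a Markov family with this diagonal; the history moved the universal logarithm's coefficient.
(`T4TwoLoopLaw.tendsto_div_log_of_abs_sub_le` BY NAME.) [cite: Balaban1987RG1, Thm 2 p.259] -/
theorem tendsto_twoLoopCoeff_bareOf_family
    (hβ : ∀ (k : ℕ) (p : Fin (k + 1) → ℝ), β k p = b + c * p (Fin.last k) * (p (Fin.last k) - p 0))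
    (hb : 0 < b) (hc : 0 < c) (hγ : 0 < γ) (hsmall : 2 * c * γ ^ 2 ≤ b) {g : ℝ} (hg : 0 < g) (hgγ : g ≤ γ) :
    Tendsto (fun K : ℕ => (1 / (bareOf β γ K g) ^ 2 - 1 / g ^ 2 - (K : ℝ) * b) / Real.log K) atTop (𝓝 (c / b)) := by
  refine tendsto_div_log_of_abs_sub_le (k₀ := 0)
    (Cst := twoLoopConst (b / 2) b γ (c * γ) 0 0 c 0 0 0 0 (1 / g ^ 2) + 4 * c / b) fun K hK => ?_
  have hex : ∃ gs : ℕ → ℝ, gs K = g ∧ RGEqH K β gs ∧ ∀ k, k ≤ K → 0 < gs k ∧ gs k ≤ γ :=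
    runs_exist hβ hb hc.le hγ hsmall K hg hgγ
  have e : bareOf β γ K g = (Classical.choose hex) 0 := by unfold bareOf; rw [dif_pos hex]
  have hspec := Classical.choose_spec hex
  have hlaw := (boundedWeight_not_sufficient_for_value hβ hb hc hγ hsmall hg hgγ).1 K (Classical.choose hex) hK
    hspec.2.1 hspec.2.2 hspec.1
  rw [e]
  exact hlaw

/-- **NON-VACUITY OF (E30)'s FADING-MEMORY BINDERS** (sanity; node U2's §7 family): the MARKOV two-loop family
`β_{k+1}(p) = b + c·p_k²` (`b > 0`, `c ≥ 0`, any `γ > 0`) carries a printed split with one-loop part `b`, (AF-1) with `C₁ = cγ`, the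
DIAGONAL (TL) with `β¹¹_∞ = c`, `C₃ = c₁ = 0`, the box-level sign and upper bound, `EventualLowerH b γ 0`, node U2's `HistLipschitz` with
the last-only modulus `Λ k i = 2cγ·[i = k]` and `FadingMemory (2cγ) 0 Λ` — every binder of (E30)'s `twoLoopLaw_of_diagTL_of_fadingMemory`
beyond the run itself, jointly; there the history channel is silent (first moment 0), as it must be on a Markov family. [folklore] -/
theorem e30_binders_inhabited {b c γ : ℝ} (hb : 0 < b) (hc : 0 ≤ c) (hγ : 0 < γ) :
    let βm : HBeta := fun k p => b + c * p (Fin.last k) ^ 2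
    let Λ : ℕ → ℕ → ℝ := fun k i => if i = k then 2 * c * γ else 0
    (∃ S : B12Beta.OneLoopSplit βm, (∀ k, S.β0 k = b) ∧
        (∀ (k : ℕ) (p : Fin (k + 1) → ℝ), p ∈ Box γ k → |S.β1 k p| ≤ c * γ * p (Fin.last k)) ∧
        ∀ (k : ℕ) (x : ℝ), 0 < x → x ≤ γ → |S.β1 k (fun _ : Fin (k + 1) => x) - c * x ^ 2| ≤ 0 * x ^ 3 + 0 * (0 : ℝ) ^ k) ∧
      BetaLowerH 0 γ βm ∧ BetaUpperH (b + c * γ ^ 2) γ βm ∧ EventualLowerH b γ 0 βm ∧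
      HistLipschitz Λ γ βm ∧ FadingMemory (2 * c * γ) 0 Λ := by
  intro βm Λ
  refine ⟨⟨⟨fun _ => b, fun k p => c * p (Fin.last k) ^ 2, fun k p => rfl, fun k p hp => by simp [hp]⟩, fun _ => rfl, ?_, ?_⟩,
    ?_, ?_, ?_, ?_, ?_⟩
  · intro k p hp
    have hk := mem_box.1 hp (Fin.last k)
    show |c * p (Fin.last k) ^ 2| ≤ c * γ * p (Fin.last k)
    rw [abs_of_nonneg (by positivity)]
    nlinarith [mul_le_mul_of_nonneg_left hk.2 (mul_nonneg hc hk.1.le)]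
  · intro k x hx hxγ
    show |c * x ^ 2 - c * x ^ 2| ≤ 0 * x ^ 3 + 0 * (0 : ℝ) ^ k
    simp
  · intro k p hp
    show (0 : ℝ) ≤ b + c * p (Fin.last k) ^ 2
    positivity
  · intro k p hp
    have hk := mem_box.1 hp (Fin.last k)
    show b + c * p (Fin.last k) ^ 2 ≤ b + c * γ ^ 2
    nlinarith [mul_le_mul_of_nonneg_left (pow_le_pow_left₀ hk.1.le hk.2 2) hc]
  · intro k p _ hp
    show b ≤ b + c * p (Fin.last k) ^ 2
    nlinarith [mul_nonneg hc (sq_nonneg (p (Fin.last k)))]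
  · intro k p q hp hq
    have hpk := mem_box.1 hp (Fin.last k); have hqk := mem_box.1 hq (Fin.last k)
    have hterm : 2 * c * γ * |p (Fin.last k) - q (Fin.last k)| ≤ ∑ i : Fin (k + 1), Λ k i * |p i - q i| := by
      have hnn : ∀ i ∈ (univ : Finset (Fin (k + 1))), 0 ≤ Λ k i * |p i - q i| :=
        fun i _ => mul_nonneg (by dsimp only [Λ]; split_ifs <;> positivity) (abs_nonneg _)
      have h1 := single_le_sum hnn (mem_univ (Fin.last k))
      have e : Λ k (Fin.last k) = 2 * c * γ := by simp [Λ]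
      rw [e] at h1
      exact h1
    calc |βm k p - βm k q| = c * (|p (Fin.last k) + q (Fin.last k)| * |p (Fin.last k) - q (Fin.last k)|) := by
          show |b + c * p (Fin.last k) ^ 2 - (b + c * q (Fin.last k) ^ 2)| = _
          rw [← abs_mul, show b + c * p (Fin.last k) ^ 2 - (b + c * q (Fin.last k) ^ 2) =
            c * ((p (Fin.last k) + q (Fin.last k)) * (p (Fin.last k) - q (Fin.last k))) by ring, abs_mul, abs_of_nonneg hc]
      _ ≤ c * (2 * γ * |p (Fin.last k) - q (Fin.last k)|) := by
          refine mul_le_mul_of_nonneg_left (mul_le_mul_of_nonneg_right ?_ (abs_nonneg _)) hc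
          rw [abs_le]; constructor <;> linarith [hpk.1, hpk.2, hqk.1, hqk.2]
      _ = 2 * c * γ * |p (Fin.last k) - q (Fin.last k)| := by ring
      _ ≤ _ := hterm
  · intro k i hik
    dsimp only [Λ]
    by_cases h : i = k
    · subst h; simp; positivity
    · have hlt : i < k := lt_of_le_of_ne hik h
      rw [if_neg h, zero_pow (Nat.sub_ne_zero_of_lt hlt)]
      simp

/-- **INSTANCE** (non-vacuity, by `rfl`): the explicit family `β k p := b + c·p_k·(p_k − p_0)` with `b = 1`, `c = 1`, `γ = 1∕2`
(`2cγ² = 1∕2 ≤ 1`) exhibits (E30b) for every renormalized `g ∈ ]0, 1∕2]`, together with its non-fading two-point `HistLipschitz`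
modulus and its two-loop-free diagonal. [folklore] -/
theorem family_boundedWeight_not_sufficient {g : ℝ} (hg : 0 < g) (hgγ : g ≤ 1 / 2) :
    let βw : HBeta := fun k p => 1 + 1 * p (Fin.last k) * (p (Fin.last k) - p 0)
    HistLipschitz (fun k i => if i = k then 3 * 1 * (1 / 2 : ℝ) else if i = 0 then 1 * (1 / 2 : ℝ) else 0) (1 / 2) βw ∧
      (∀ (C θ : ℝ), 0 ≤ θ → θ < 1 →
        ¬ FadingMemory C θ (fun k i => if i = k then 3 * 1 * (1 / 2 : ℝ) else if i = 0 then 1 * (1 / 2 : ℝ) else 0)) ∧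
      (∃ S : B12Beta.OneLoopSplit βw, (∀ k, S.β0 k = 1) ∧
        ∀ (k : ℕ) (x : ℝ), 0 < x → x ≤ 1 / 2 → |S.β1 k (fun _ : Fin (k + 1) => x) - 0 * x ^ 2| ≤ 0 * x ^ 3 + 0 * (0 : ℝ) ^ k) ∧
      ¬ ∃ Q' : ℝ, ∀ (K : ℕ) (gs : ℕ → ℝ), 0 < K → RGEqH K βw gs → (∀ k, k ≤ K → 0 < gs k ∧ gs k ≤ 1 / 2) →
        gs K = g → |1 / (gs 0) ^ 2 - 1 / g ^ 2 - (K : ℝ) * 1| ≤ Q' := by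
  intro βw
  have hβ : ∀ (k : ℕ) (p : Fin (k + 1) → ℝ), βw k p = 1 + 1 * p (Fin.last k) * (p (Fin.last k) - p 0) := fun _ _ => rfl
  have hsmall : 2 * (1 : ℝ) * (1 / 2) ^ 2 ≤ 1 := by norm_num
  obtain ⟨S, hS⟩ := exists_split hβ
  refine ⟨histLipschitz hβ zero_le_one (by norm_num), fun C θ hθ0 hθ1 => not_fadingMemory one_pos (by norm_num) hθ0 hθ1,
    ⟨S, hS, fun k x hx hxγ => diagTL_zero hβ S hS k x hx hxγ⟩, ?_⟩
  have h := (boundedWeight_not_sufficient_for_value hβ one_pos one_pos (by norm_num) hsmall hg hgγ).2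
  simpa using h

end Summit.QuantumFields.BalabanUV.Beta.EriceRemainderEnclosureHistoryTwoLoopSharp
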